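import Mathlib.Algebra.Order.BigOperators.Group.Finset
import Mathlib.Tactic
import HarnessLib
import HarnessLib.Audit.Tags

/-!
# Purely inseparable four-folds — the C∞ GAME, EXACT-TRANSPORT form (arbitrary supports)
# (cell `res-dim4-pi`, K2(p) lane, slice B brick K24b-α, variant (a) for power-series frames)

[OURS · counted 0 · cell `res-dim4-pi` · lane holder res-dim4-p-12 g3's brick by signature (bus 2026-08-29
01:52Z); game/tables res-dim4-idea-4 g3/g4 (00:46Z, 02:11Z, 02:17Z (R1)/(R2)); proof res-dim4-p-9 g3; seat
res-dim4-p-9 g3.]  Nothing here proves K2(p)/K2(5), `NoIsolatedTrap p p` or resolution of singularities in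
dimension ≥ 4 / characteristic `p`; this is the series-ready twin of `…ResConeCInfGame` (p689621): the SAME
game, the finiteness of the initial support REPLACED by the forward transport law of a pure corner step.
Monomials `(c, a, b, e)` = `x_λ^a x_μ^b ū^e` in the family of constant `c` (3, 2, 2, 1 for `B₀, B₁, S₁, S₂`);
word `x : ℕ → Bool` (`true = λ`); λ-STEP `(c, a, b, e) ↦ (c, a + b + e − c, b, e)`, μ-STEP the mirror; DEAD
`c ≤ a + e ∧ c ≤ b + e` (the frame's cleaning / re-straightening noise lives there); λ-WITNESS `b + e + 1 ≤ c`,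
μ-WITNESS `a + e + 1 ≤ c`; LEGAL(λ) `2c ≤ a + 2b + 2e` for everybody present, LEGAL(μ) `2c ≤ 2a + b + 2e`.
Binders over COMPONENTS (no projections, no `if`): `hC` family constants `≤ C`; `hfwdL/hfwdM` FORWARD law for
LIVE images (exact transport inside a family); `hevol` BACKWARD law for LIVE monomials (present at `t + 1` ⇒
dead or an image); `hlegL/hlegM`, `hflagL/hflagM` idea-4's LEGAL tables and both isolation flags.
**`Exact.no_infinite_play`**: no word and no play (of ANY support size) satisfy all of these.
Proof (no certificate): (1) `present_not_double` — a present monomial is never a DOUBLE witness (trap: every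
legal step lowers `a + b`, live images stay present); (2) `lambda_step_bound` — at a λ-step every λ-witness has
`2c ≤ a + b + 2e`; (3) `lambda_witness_pre` — a λ-witness at `t + 1` is the image of a λ-witness in
`c ≤ a + e`, `a` dropping at λ-steps; (4) after ANY μ-step every λ-witness has `#λ since + a + 2e + 1 ≤ 2c`,
so with (2) **at most `C − 1` further λ-steps** (`few_lambda_after_mu`); (5) mirror by `a ↔ b`, `x ↦ !x`
(`Mirror.*`); (6) constant tails die by single-witness descent; (7) ⊥.

bears_on: LADDER-RESOLUTION:D157-DOOR2 (res-dim4-pi · K2(p) · slice B · K24b-α exact form).  Supports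
stmt-ResolutionOfSingularities-16155 (helper).
-/

set_option linter.dupNamespace false -- mandated namespace of this single-conjunct summit

namespace Summit.ResolutionOfSingularities.ResolutionOfSingularities.Theorems.PIDim4

namespace ResCone

namespace CInfGame

namespace Exact

open Finset

variable {x : ℕ → Bool} {P : ℕ → ℕ × ℕ × ℕ × ℕ → Prop} {C : ℕ}

/-- **A present monomial is never a double witness** (`a + e + 1 ≤ c ∧ b + e + 1 ≤ c`): there every legal
step lowers `a + b`, keeps the region, and the (live) image stays present. [OURS] [folklore] -/
theorem present_not_double
    (hfwdL : ∀ t c a b e, P t (c, a, b, e) → x t = true →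
      ¬ (c ≤ a + b + e - c + e ∧ c ≤ b + e) → P (t + 1) (c, a + b + e - c, b, e))
    (hfwdM : ∀ t c a b e, P t (c, a, b, e) → x t = false →
      ¬ (c ≤ a + e ∧ c ≤ a + b + e - c + e) → P (t + 1) (c, a, a + b + e - c, e))
    (hlegL : ∀ t c a b e, P t (c, a, b, e) → x t = true → 2 * c ≤ a + 2 * b + 2 * e)
    (hlegM : ∀ t c a b e, P t (c, a, b, e) → x t = false → 2 * c ≤ 2 * a + b + 2 * e)
    {t c a b e : ℕ} (hm : P t (c, a, b, e)) (ha : a + e + 1 ≤ c) (hb : b + e + 1 ≤ c) : False := by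
  suffices key : ∀ n t a b, a + b ≤ n → P t (c, a, b, e) → a + e + 1 ≤ c → b + e + 1 ≤ c → False from
    key (a + b) t a b le_rfl hm ha hb
  intro n
  induction n with
  | zero =>
    intro t a b hn hm ha hb
    cases hx : x t with
    | true => have l := hlegL t c a b e hm hx; omega
    | false => have l := hlegM t c a b e hm hx; omega
  | succ n ih =>
    intro t a b hn hm ha hb
    cases hx : x t with
    | true =>
      have l := hlegL t c a b e hm hx
      have hP := hfwdL t c a b e hm hx (by omega)
      exact ih (t + 1) (a + b + e - c) b (by omega) hP (by omega) (by omega)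
    | false =>
      have l := hlegM t c a b e hm hx
      have hP := hfwdM t c a b e hm hx (by omega)
      exact ih (t + 1) a (a + b + e - c) (by omega) hP (by omega) (by omega)

/-- A present λ-witness lies in `c ≤ a + e`. [OURS] [folklore] -/
theorem lambda_witness_L
    (hfwdL : ∀ t c a b e, P t (c, a, b, e) → x t = true →
      ¬ (c ≤ a + b + e - c + e ∧ c ≤ b + e) → P (t + 1) (c, a + b + e - c, b, e))
    (hfwdM : ∀ t c a b e, P t (c, a, b, e) → x t = false →
      ¬ (c ≤ a + e ∧ c ≤ a + b + e - c + e) → P (t + 1) (c, a, a + b + e - c, e))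
    (hlegL : ∀ t c a b e, P t (c, a, b, e) → x t = true → 2 * c ≤ a + 2 * b + 2 * e)
    (hlegM : ∀ t c a b e, P t (c, a, b, e) → x t = false → 2 * c ≤ 2 * a + b + 2 * e)
    {t c a b e : ℕ} (hm : P t (c, a, b, e)) (hb : b + e + 1 ≤ c) : c ≤ a + e := by
  by_contra h
  exact present_not_double hfwdL hfwdM hlegL hlegM hm (by omega) hb

/-- **λ-step bound**: at a λ-step every present λ-witness has `2c ≤ a + b + 2e` (its image is a live
λ-witness, present by the forward law, hence in `c ≤ a' + e`). [OURS] [folklore] -/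
theorem lambda_step_bound
    (hfwdL : ∀ t c a b e, P t (c, a, b, e) → x t = true →
      ¬ (c ≤ a + b + e - c + e ∧ c ≤ b + e) → P (t + 1) (c, a + b + e - c, b, e))
    (hfwdM : ∀ t c a b e, P t (c, a, b, e) → x t = false →
      ¬ (c ≤ a + e ∧ c ≤ a + b + e - c + e) → P (t + 1) (c, a, a + b + e - c, e))
    (hlegL : ∀ t c a b e, P t (c, a, b, e) → x t = true → 2 * c ≤ a + 2 * b + 2 * e)
    (hlegM : ∀ t c a b e, P t (c, a, b, e) → x t = false → 2 * c ≤ 2 * a + b + 2 * e)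
    {t c a b e : ℕ} (hx : x t = true) (hm : P t (c, a, b, e)) (hb : b + e + 1 ≤ c) :
    2 * c ≤ a + b + 2 * e := by
  have ha := lambda_witness_L hfwdL hfwdM hlegL hlegM hm hb
  have hP := hfwdL t c a b e hm hx (by omega)
  have := lambda_witness_L hfwdL hfwdM hlegL hlegM hP hb
  omega

/-- **Predecessor of a λ-witness**: a λ-witness present at `t + 1` is the image of a present λ-witness in
`c ≤ a₀ + e` (a μ-only predecessor would put the image in the trap, a dead one is excluded). [OURS] -/
theorem lambda_witness_pre
    (hfwdL : ∀ t c a b e, P t (c, a, b, e) → x t = true →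
      ¬ (c ≤ a + b + e - c + e ∧ c ≤ b + e) → P (t + 1) (c, a + b + e - c, b, e))
    (hfwdM : ∀ t c a b e, P t (c, a, b, e) → x t = false →
      ¬ (c ≤ a + e ∧ c ≤ a + b + e - c + e) → P (t + 1) (c, a, a + b + e - c, e))
    (hlegL : ∀ t c a b e, P t (c, a, b, e) → x t = true → 2 * c ≤ a + 2 * b + 2 * e)
    (hlegM : ∀ t c a b e, P t (c, a, b, e) → x t = false → 2 * c ≤ 2 * a + b + 2 * e)
    (hevol : ∀ t c a b e, P (t + 1) (c, a, b, e) → (c ≤ a + e ∧ c ≤ b + e) ∨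
      ∃ a₀ b₀, P t (c, a₀, b₀, e) ∧ ((x t = true ∧ a = a₀ + b₀ + e - c ∧ b = b₀) ∨
        (x t = false ∧ a = a₀ ∧ b = a₀ + b₀ + e - c)))
    {t c a b e : ℕ} (hm : P (t + 1) (c, a, b, e)) (hb : b + e + 1 ≤ c) :
    ∃ a₀ b₀, P t (c, a₀, b₀, e) ∧ b₀ + e + 1 ≤ c ∧ c ≤ a₀ + e ∧
      ((x t = true ∧ a = a₀ + b₀ + e - c ∧ b = b₀) ∨ (x t = false ∧ a = a₀ ∧ b = a₀ + b₀ + e - c)) := by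
  rcases hevol t c a b e hm with hdead | ⟨a₀, b₀, hm₀, hcase⟩
  · exfalso; omega
  · rcases hcase with ⟨hx, ha, hb0⟩ | ⟨hx, ha, hb0⟩
    · have hb₀ : b₀ + e + 1 ≤ c := by omega
      exact ⟨a₀, b₀, hm₀, hb₀, lambda_witness_L hfwdL hfwdM hlegL hlegM hm₀ hb₀, Or.inl ⟨hx, ha, hb0⟩⟩
    · have haL : c ≤ a₀ + e := by
        by_contra h
        exact present_not_double hfwdL hfwdM hlegL hlegM hm (by omega) hb
      have hb₀ : b₀ + e + 1 ≤ c := by omega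
      exact ⟨a₀, b₀, hm₀, hb₀, haL, Or.inr ⟨hx, ha, hb0⟩⟩

/-- **After a μ-step every λ-witness has `a + 2e + 1 ≤ 2c`** (its ancestor at the μ-step had `c ≤ a + e`
and image `b = b₀ + (a + e − c) < c − e`; later `a` only drops). [OURS] [folklore] -/
theorem after_mu_bound
    (hfwdL : ∀ t c a b e, P t (c, a, b, e) → x t = true →
      ¬ (c ≤ a + b + e - c + e ∧ c ≤ b + e) → P (t + 1) (c, a + b + e - c, b, e))
    (hfwdM : ∀ t c a b e, P t (c, a, b, e) → x t = false →
      ¬ (c ≤ a + e ∧ c ≤ a + b + e - c + e) → P (t + 1) (c, a, a + b + e - c, e))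
    (hlegL : ∀ t c a b e, P t (c, a, b, e) → x t = true → 2 * c ≤ a + 2 * b + 2 * e)
    (hlegM : ∀ t c a b e, P t (c, a, b, e) → x t = false → 2 * c ≤ 2 * a + b + 2 * e)
    (hevol : ∀ t c a b e, P (t + 1) (c, a, b, e) → (c ≤ a + e ∧ c ≤ b + e) ∨
      ∃ a₀ b₀, P t (c, a₀, b₀, e) ∧ ((x t = true ∧ a = a₀ + b₀ + e - c ∧ b = b₀) ∨
        (x t = false ∧ a = a₀ ∧ b = a₀ + b₀ + e - c)))
    {s₁ : ℕ} (hs : x s₁ = false) (k : ℕ) :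
    ∀ c a b e, P (s₁ + 1 + k) (c, a, b, e) → b + e + 1 ≤ c → a + 2 * e + 1 ≤ 2 * c := by
  induction k with
  | zero =>
    intro c a b e hm hb
    obtain ⟨a₀, b₀, _, hb₀, ha₀, hcase⟩ := lambda_witness_pre hfwdL hfwdM hlegL hlegM hevol hm hb
    rcases hcase with ⟨hx, _, _⟩ | ⟨_, ha, hb'⟩
    · rw [hs] at hx; exact absurd hx (by decide)
    · omega
  | succ k ih =>
    intro c a b e hm hb
    rw [show s₁ + 1 + (k + 1) = s₁ + 1 + k + 1 from rfl] at hm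
    obtain ⟨a₀, b₀, hm₀, hb₀, ha₀, hcase⟩ := lambda_witness_pre hfwdL hfwdM hlegL hlegM hevol hm hb
    have := ih c a₀ b₀ e hm₀ hb₀
    rcases hcase with ⟨_, ha, hb'⟩ | ⟨_, ha, hb'⟩ <;> omega

/-- **Counting form**: from any time `t` after a μ-step, every λ-witness present at `t + k` satisfies
`#{i < k : x (t + i) = λ} + a + 2e + 1 ≤ 2c`. [OURS] [folklore] -/
theorem after_mu_count
    (hfwdL : ∀ t c a b e, P t (c, a, b, e) → x t = true →
      ¬ (c ≤ a + b + e - c + e ∧ c ≤ b + e) → P (t + 1) (c, a + b + e - c, b, e))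
    (hfwdM : ∀ t c a b e, P t (c, a, b, e) → x t = false →
      ¬ (c ≤ a + e ∧ c ≤ a + b + e - c + e) → P (t + 1) (c, a, a + b + e - c, e))
    (hlegL : ∀ t c a b e, P t (c, a, b, e) → x t = true → 2 * c ≤ a + 2 * b + 2 * e)
    (hlegM : ∀ t c a b e, P t (c, a, b, e) → x t = false → 2 * c ≤ 2 * a + b + 2 * e)
    (hevol : ∀ t c a b e, P (t + 1) (c, a, b, e) → (c ≤ a + e ∧ c ≤ b + e) ∨
      ∃ a₀ b₀, P t (c, a₀, b₀, e) ∧ ((x t = true ∧ a = a₀ + b₀ + e - c ∧ b = b₀) ∨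
        (x t = false ∧ a = a₀ ∧ b = a₀ + b₀ + e - c)))
    {s₁ t : ℕ} (hs : x s₁ = false) (ht : s₁ + 1 ≤ t) (k : ℕ) :
    ∀ c a b e, P (t + k) (c, a, b, e) → b + e + 1 ≤ c →
      (∑ i ∈ range k, (x (t + i)).toNat) + a + 2 * e + 1 ≤ 2 * c := by
  induction k with
  | zero =>
    intro c a b e hm hb
    rw [show t + 0 = s₁ + 1 + (t - (s₁ + 1)) from by omega] at hm
    have := after_mu_bound hfwdL hfwdM hlegL hlegM hevol hs _ c a b e hm hb
    simpa using this
  | succ k ih =>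
    intro c a b e hm hb
    rw [show t + (k + 1) = t + k + 1 from rfl] at hm
    obtain ⟨a₀, b₀, hm₀, hb₀, ha₀, hcase⟩ := lambda_witness_pre hfwdL hfwdM hlegL hlegM hevol hm hb
    have := ih c a₀ b₀ e hm₀ hb₀
    rw [sum_range_succ]
    rcases hcase with ⟨hx, ha, hb'⟩ | ⟨hx, ha, hb'⟩
    · rw [hx, Bool.toNat_true]; omega
    · rw [hx, Bool.toNat_false]; omega

/-- **After a μ-step at most `C − 1` further λ-steps**: from any time `t` after a μ-step,
`#{i < k : x (t + i) = λ} + 1 ≤ C` for every `k`. [OURS] [folklore] -/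
theorem few_lambda_after_mu
    (hC : ∀ t c a b e, P t (c, a, b, e) → c ≤ C)
    (hfwdL : ∀ t c a b e, P t (c, a, b, e) → x t = true →
      ¬ (c ≤ a + b + e - c + e ∧ c ≤ b + e) → P (t + 1) (c, a + b + e - c, b, e))
    (hfwdM : ∀ t c a b e, P t (c, a, b, e) → x t = false →
      ¬ (c ≤ a + e ∧ c ≤ a + b + e - c + e) → P (t + 1) (c, a, a + b + e - c, e))
    (hlegL : ∀ t c a b e, P t (c, a, b, e) → x t = true → 2 * c ≤ a + 2 * b + 2 * e)
    (hlegM : ∀ t c a b e, P t (c, a, b, e) → x t = false → 2 * c ≤ 2 * a + b + 2 * e)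
    (hevol : ∀ t c a b e, P (t + 1) (c, a, b, e) → (c ≤ a + e ∧ c ≤ b + e) ∨
      ∃ a₀ b₀, P t (c, a₀, b₀, e) ∧ ((x t = true ∧ a = a₀ + b₀ + e - c ∧ b = b₀) ∨
        (x t = false ∧ a = a₀ ∧ b = a₀ + b₀ + e - c)))
    (hflagL : ∀ t, ∃ c a b e, P t (c, a, b, e) ∧ b + e + 1 ≤ c)
    {s₁ t : ℕ} (hs : x s₁ = false) (ht : s₁ + 1 ≤ t) (k : ℕ) :
    (∑ i ∈ range k, (x (t + i)).toNat) + 1 ≤ C := by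
  induction k with
  | zero =>
    obtain ⟨c, a, b, e, hm, hb⟩ := hflagL 0
    have := hC 0 c a b e hm
    simp only [range_zero, sum_empty]
    omega
  | succ k ih =>
    rw [sum_range_succ]
    cases hx : x (t + k) with
    | false => rw [Bool.toNat_false]; omega
    | true =>
      rw [Bool.toNat_true]
      obtain ⟨c, a, b, e, hm, hb⟩ := hflagL (t + k)
      have h1 := after_mu_count hfwdL hfwdM hlegL hlegM hevol hs ht k c a b e hm hb
      have h2 := lambda_step_bound hfwdL hfwdM hlegL hlegM hx hm hb
      have h3 := hC _ c a b e hm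
      omega

/-- **A λ-tail dies**: if `x s = λ` for all `s ≥ s₀`, the λ-flag witness at `s₀` stays present (forward law)
and its `a` drops at every step. [OURS] [folklore] -/
theorem lambda_tail_dies
    (hfwdL : ∀ t c a b e, P t (c, a, b, e) → x t = true →
      ¬ (c ≤ a + b + e - c + e ∧ c ≤ b + e) → P (t + 1) (c, a + b + e - c, b, e))
    (hfwdM : ∀ t c a b e, P t (c, a, b, e) → x t = false →
      ¬ (c ≤ a + e ∧ c ≤ a + b + e - c + e) → P (t + 1) (c, a, a + b + e - c, e))
    (hlegL : ∀ t c a b e, P t (c, a, b, e) → x t = true → 2 * c ≤ a + 2 * b + 2 * e)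
    (hlegM : ∀ t c a b e, P t (c, a, b, e) → x t = false → 2 * c ≤ 2 * a + b + 2 * e)
    (hflagL : ∀ t, ∃ c a b e, P t (c, a, b, e) ∧ b + e + 1 ≤ c)
    {s₀ : ℕ} (htail : ∀ s, s₀ ≤ s → x s = true) : False := by
  obtain ⟨c, a, b, e, hm, hb⟩ := hflagL s₀
  have key : ∀ k, ∃ a', P (s₀ + k) (c, a', b, e) ∧ a' + k ≤ a := by
    intro k
    induction k with
    | zero => exact ⟨a, hm, by omega⟩
    | succ k ih =>
      obtain ⟨a', hm', hk⟩ := ih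
      have hx := htail (s₀ + k) (by omega)
      have h2 := lambda_step_bound hfwdL hfwdM hlegL hlegM hx hm' hb
      have hP := hfwdL _ c a' b e hm' hx (by omega)
      exact ⟨a' + b + e - c, hP, by omega⟩
  obtain ⟨a', _, hk⟩ := key (a + 1)
  omega

namespace Mirror

/-- Mirror of `hC`. [folklore] -/
theorem hC (hC : ∀ t c a b e, P t (c, a, b, e) → c ≤ C) : ∀ t c a b e, P t (c, b, a, e) → c ≤ C :=
  fun t c a b e hm => hC t c b a e hm

/-- Mirror forward law (λ' from μ). [folklore] -/
theorem hfwdL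
    (hfwdM : ∀ t c a b e, P t (c, a, b, e) → x t = false →
      ¬ (c ≤ a + e ∧ c ≤ a + b + e - c + e) → P (t + 1) (c, a, a + b + e - c, e)) :
    ∀ t c a b e, P t (c, b, a, e) → (!x t) = true →
      ¬ (c ≤ a + b + e - c + e ∧ c ≤ b + e) → P (t + 1) (c, b, a + b + e - c, e) := by
  intro t c a b e hm hx hnd
  have hx' : x t = false := by simpa using hx
  have h := hfwdM t c b a e hm hx' (by rw [Nat.add_comm b a]; omega)
  rw [Nat.add_comm b a] at h
  exact h

/-- Mirror forward law (μ' from λ). [folklore] -/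
theorem hfwdM
    (hfwdL : ∀ t c a b e, P t (c, a, b, e) → x t = true →
      ¬ (c ≤ a + b + e - c + e ∧ c ≤ b + e) → P (t + 1) (c, a + b + e - c, b, e)) :
    ∀ t c a b e, P t (c, b, a, e) → (!x t) = false →
      ¬ (c ≤ a + e ∧ c ≤ a + b + e - c + e) → P (t + 1) (c, a + b + e - c, a, e) := by
  intro t c a b e hm hx hnd
  have hx' : x t = true := by simpa using hx
  have h := hfwdL t c b a e hm hx' (by rw [Nat.add_comm b a]; omega)
  rw [Nat.add_comm b a] at h
  exact h

/-- Mirror backward law. [folklore] -/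
theorem hevol
    (hevol : ∀ t c a b e, P (t + 1) (c, a, b, e) → (c ≤ a + e ∧ c ≤ b + e) ∨
      ∃ a₀ b₀, P t (c, a₀, b₀, e) ∧ ((x t = true ∧ a = a₀ + b₀ + e - c ∧ b = b₀) ∨
        (x t = false ∧ a = a₀ ∧ b = a₀ + b₀ + e - c))) :
    ∀ t c a b e, P (t + 1) (c, b, a, e) → (c ≤ a + e ∧ c ≤ b + e) ∨
      ∃ a₀ b₀, P t (c, b₀, a₀, e) ∧ (((!x t) = true ∧ a = a₀ + b₀ + e - c ∧ b = b₀) ∨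
        ((!x t) = false ∧ a = a₀ ∧ b = a₀ + b₀ + e - c)) := by
  intro t c a b e hm
  rcases hevol t c b a e hm with hdead | ⟨a₁, b₁, hm₁, hcase⟩
  · exact Or.inl ⟨hdead.2, hdead.1⟩
  · refine Or.inr ⟨b₁, a₁, hm₁, ?_⟩
    rcases hcase with ⟨hx, h1, h2⟩ | ⟨hx, h1, h2⟩
    · right; refine ⟨by simp [hx], h2, ?_⟩; rw [h1, Nat.add_comm a₁ b₁]
    · left; refine ⟨by simp [hx], ?_, h1⟩; rw [h2, Nat.add_comm a₁ b₁]

/-- Mirror legality (λ' from μ). [folklore] -/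
theorem hlegL (hlegM : ∀ t c a b e, P t (c, a, b, e) → x t = false → 2 * c ≤ 2 * a + b + 2 * e) :
    ∀ t c a b e, P t (c, b, a, e) → (!x t) = true → 2 * c ≤ a + 2 * b + 2 * e := by
  intro t c a b e hm hx
  have hx' : x t = false := by simpa using hx
  have := hlegM t c b a e hm hx'; omega

/-- Mirror legality (μ' from λ). [folklore] -/
theorem hlegM (hlegL : ∀ t c a b e, P t (c, a, b, e) → x t = true → 2 * c ≤ a + 2 * b + 2 * e) :
    ∀ t c a b e, P t (c, b, a, e) → (!x t) = false → 2 * c ≤ 2 * a + b + 2 * e := by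
  intro t c a b e hm hx
  have hx' : x t = true := by simpa using hx
  have := hlegL t c b a e hm hx'; omega

/-- Mirror flag (λ' from μ). [folklore] -/
theorem hflagL (hflagM : ∀ t, ∃ c a b e, P t (c, a, b, e) ∧ a + e + 1 ≤ c) :
    ∀ t, ∃ c a b e, P t (c, b, a, e) ∧ b + e + 1 ≤ c := by
  intro t
  obtain ⟨c, a, b, e, hm, ha⟩ := hflagM t
  exact ⟨c, b, a, e, hm, ha⟩

end Mirror

/-- **After a λ-step at most `C − 1` further μ-steps** (mirror of `few_lambda_after_mu`). [OURS] [folklore] -/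
theorem few_mu_after_lambda
    (hC : ∀ t c a b e, P t (c, a, b, e) → c ≤ C)
    (hfwdL : ∀ t c a b e, P t (c, a, b, e) → x t = true →
      ¬ (c ≤ a + b + e - c + e ∧ c ≤ b + e) → P (t + 1) (c, a + b + e - c, b, e))
    (hfwdM : ∀ t c a b e, P t (c, a, b, e) → x t = false →
      ¬ (c ≤ a + e ∧ c ≤ a + b + e - c + e) → P (t + 1) (c, a, a + b + e - c, e))
    (hlegL : ∀ t c a b e, P t (c, a, b, e) → x t = true → 2 * c ≤ a + 2 * b + 2 * e)
    (hlegM : ∀ t c a b e, P t (c, a, b, e) → x t = false → 2 * c ≤ 2 * a + b + 2 * e)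
    (hevol : ∀ t c a b e, P (t + 1) (c, a, b, e) → (c ≤ a + e ∧ c ≤ b + e) ∨
      ∃ a₀ b₀, P t (c, a₀, b₀, e) ∧ ((x t = true ∧ a = a₀ + b₀ + e - c ∧ b = b₀) ∨
        (x t = false ∧ a = a₀ ∧ b = a₀ + b₀ + e - c)))
    (hflagM : ∀ t, ∃ c a b e, P t (c, a, b, e) ∧ a + e + 1 ≤ c)
    {s₁ t : ℕ} (hs : x s₁ = true) (ht : s₁ + 1 ≤ t) (k : ℕ) :
    (∑ i ∈ range k, (!x (t + i)).toNat) + 1 ≤ C :=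
  few_lambda_after_mu (x := fun s => !x s) (P := fun t m => P t (m.1, m.2.2.1, m.2.1, m.2.2.2))
    (Mirror.hC hC) (Mirror.hfwdL hfwdM) (Mirror.hfwdM hfwdL) (Mirror.hlegL hlegM) (Mirror.hlegM hlegL)
    (Mirror.hevol hevol) (Mirror.hflagL hflagM) (by simp [hs]) ht k

/-- **A μ-tail dies** (mirror of `lambda_tail_dies`). [OURS] [folklore] -/
theorem mu_tail_dies
    (hfwdL : ∀ t c a b e, P t (c, a, b, e) → x t = true →
      ¬ (c ≤ a + b + e - c + e ∧ c ≤ b + e) → P (t + 1) (c, a + b + e - c, b, e))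
    (hfwdM : ∀ t c a b e, P t (c, a, b, e) → x t = false →
      ¬ (c ≤ a + e ∧ c ≤ a + b + e - c + e) → P (t + 1) (c, a, a + b + e - c, e))
    (hlegL : ∀ t c a b e, P t (c, a, b, e) → x t = true → 2 * c ≤ a + 2 * b + 2 * e)
    (hlegM : ∀ t c a b e, P t (c, a, b, e) → x t = false → 2 * c ≤ 2 * a + b + 2 * e)
    (hflagM : ∀ t, ∃ c a b e, P t (c, a, b, e) ∧ a + e + 1 ≤ c)
    {s₀ : ℕ} (htail : ∀ s, s₀ ≤ s → x s = false) : False :=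
  lambda_tail_dies (x := fun s => !x s) (P := fun t m => P t (m.1, m.2.2.1, m.2.1, m.2.2.2))
    (Mirror.hfwdL hfwdM) (Mirror.hfwdM hfwdL) (Mirror.hlegL hlegM) (Mirror.hlegM hlegL)
    (Mirror.hflagL hflagM) (s₀ := s₀) (fun s hs => by simp [htail s hs])

/-- **THE C∞ GAME, EXACT TRANSPORT, ARBITRARY SUPPORTS: NO INFINITE LEGAL DOUBLY-FLAGGED PLAY.**
For any word `x : ℕ → Bool` (`true = λ`) and any play `P` (supports of any size) with bounded family
constants (`hC`), the FORWARD law for live images (`hfwdL/hfwdM`), the BACKWARD law for live monomials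
(`hevol`: present at `t + 1` ⇒ dead or an image), LEGAL at every time (`hlegL/hlegM` = idea-4's tables) and
BOTH isolation flags at every time (`hflagL/hflagM`): contradiction.  Dead noise (cleaning, re-straightening:
`c ≤ a + e ∧ c ≤ b + e`) is unconstrained on both sides. [OURS] [folklore] -/
theorem no_infinite_play (x : ℕ → Bool) (P : ℕ → ℕ × ℕ × ℕ × ℕ → Prop) (C : ℕ)
    (hC : ∀ t c a b e, P t (c, a, b, e) → c ≤ C)
    (hfwdL : ∀ t c a b e, P t (c, a, b, e) → x t = true →
      ¬ (c ≤ a + b + e - c + e ∧ c ≤ b + e) → P (t + 1) (c, a + b + e - c, b, e))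
    (hfwdM : ∀ t c a b e, P t (c, a, b, e) → x t = false →
      ¬ (c ≤ a + e ∧ c ≤ a + b + e - c + e) → P (t + 1) (c, a, a + b + e - c, e))
    (hlegL : ∀ t c a b e, P t (c, a, b, e) → x t = true → 2 * c ≤ a + 2 * b + 2 * e)
    (hlegM : ∀ t c a b e, P t (c, a, b, e) → x t = false → 2 * c ≤ 2 * a + b + 2 * e)
    (hevol : ∀ t c a b e, P (t + 1) (c, a, b, e) → (c ≤ a + e ∧ c ≤ b + e) ∨
      ∃ a₀ b₀, P t (c, a₀, b₀, e) ∧ ((x t = true ∧ a = a₀ + b₀ + e - c ∧ b = b₀) ∨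
        (x t = false ∧ a = a₀ ∧ b = a₀ + b₀ + e - c)))
    (hflagL : ∀ t, ∃ c a b e, P t (c, a, b, e) ∧ b + e + 1 ≤ c)
    (hflagM : ∀ t, ∃ c a b e, P t (c, a, b, e) ∧ a + e + 1 ≤ c) : False := by
  by_cases hmu : ∃ s, x s = false
  · by_cases hlam : ∃ s, x s = true
    · obtain ⟨s₁, hs₁⟩ := hmu
      obtain ⟨s₂, hs₂⟩ := hlam
      have h1 := few_lambda_after_mu hC hfwdL hfwdM hlegL hlegM hevol hflagL hs₁ (t := max s₁ s₂ + 1) (by omega) (2 * C)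
      have h2 := few_mu_after_lambda hC hfwdL hfwdM hlegL hlegM hevol hflagM hs₂ (t := max s₁ s₂ + 1) (by omega) (2 * C)
      have hsum : ∀ k, (∑ i ∈ range k, (x (max s₁ s₂ + 1 + i)).toNat) +
          (∑ i ∈ range k, (!x (max s₁ s₂ + 1 + i)).toNat) = k := by
        intro k
        induction k with
        | zero => simp
        | succ k ih =>
          rw [sum_range_succ, sum_range_succ]
          cases x (max s₁ s₂ + 1 + k) <;> simp <;> omega
      have := hsum (2 * C)
      omega
    · push Not at hlam
      exact mu_tail_dies hfwdL hfwdM hlegL hlegM hflagM (s₀ := 0) (fun s _ => by simpa using hlam s)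
  · push Not at hmu
    exact lambda_tail_dies hfwdL hfwdM hlegL hlegM hflagL (s₀ := 0) (fun s _ => by simpa using hmu s)

end Exact

end CInfGame

end ResCone

end Summit.ResolutionOfSingularities.ResolutionOfSingularities.Theorems.PIDim4
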